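import Summits.ResolutionOfSingularities.ResolutionOfSingularities.Theorems.KangarooTransport
import HarnessLib

/-!
# KangarooTowers — decomp-res node «KangarooCut» (lens-4 g24, critic rows 148/148a), tree file 3/5 of the node

Content VERBATIM from the decomp-res lens-4 g24 TREE-FACING COMPANION
`HOME/decomp-res-lens-4/g24/tree/KangarooCutTree.lean` (sha256 76e53063…, 770 l;
HOME = run/shared/lean/pub/decomp-res) = the NEW PART §60–§63 of the node
`HOME/decomp-res-lens-4/g24/KangarooCut.lean` (pin f422af60, l. 1026–1759, byte-identical);
the node's carried g23 block «FrobeniusForm» is ALREADY in the tree as `Theorems/FrobeniusGain` ·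
`PPowerFormLucas` · `PPowerForm` · `PPowerTowers` and is not
landed again.  Critic: CRITIC-LEDGER rows 148 (CLEARED, DECIDED +1: the jump-free bed ⊆ `ContactHugging`) and 148a
(the companion = the landing unit); landing
order 2026-08-30T22:00:50Z / 22:19:25Z.  Landed by decomp-res writer g8 in the lens's namespace
`…Theorems.HugValuationCut`, split CONE-AWARE for the
400-line limit: `PPowerSpan` (§60) · `KangarooTransport` (§61) · `KangarooTowers` (§62) · `KangarooCutCells`
(§63 minus the three 31571 up-links) are
OUTSIDE the Theses cone (importable by the route file); `MaxContactCutKangarooCut` (§63's three `_of_item` up-links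
from `MaxContactCut.NoContactHuggingTowers`)
is the in-cone wiring file.  All `--supports stmt-ResolutionOfSingularities-28338`.  Aside bookkeeping (critic row
148 / rider 22:00:50Z (3)): exactly ONE
successor aside `NoWildKangarooOffLocusTowers` (home `KangarooCutCells`) SUPERSEDES 28338
`LCNoWildContactFreeOffLocusTowers` once this node and
`Theorems/ContactFreeIsPPower` (lens-6 g19 companion, every-field iff `noWildContactFreeOffLocusTowers_iff_pPower`)
are both in the tree — exactness chain
`noWildContactFreeOffLocusTowers_iff_pPower` + `noWildPPowerOffLocusTowers_iff_kangaroo (h31571)`.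

§62 (companion l. 346–633) ALONG lens-4's `ForcedTower`: stagewise transport (`wInv_succ_transport`,
`wInv_or_tailJump_succ`, `wInv_succ_iff_shapeAt`),
`JumpFreeFrom` / `EventuallyJumpFree` / `ShapeStableFrom` / `EventuallyShapeStable` and their iffs,
`contactHugging_of_eventuallyJumpFree` (THE DECIDED HALF:
the jump-free bed ⊆ `ContactHugging`), `weakContactAt_of_pPowerFormAt`, `exists_wInv_every_stage_of_pPowerTower`,
`tailJump_after_every_stage`
(KERNEL, PROVED, 0 sorry; uses the tree's `FInjectiveMacaulayfication.CentreSpread.centreSpread`).  Imports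
`KangarooTransport`.  Cone-free.

[WRITER NOTE (decomp-res writer g8): section split only; namespace, universes, section variables and every
declaration exactly as in the companion
(global `set_option` dropped; the cone import `MaxContactCutTameCut` of the companion is replaced in the cone-free
files by the cone-free homes of what the
proofs use: `AbsoluteGiraudKernel` (`AbsoluteContactClasses.point_round_chart`),
`FrobeniusLadderFInjectiveMacaulayficationCentreSpread` (`centreSpread`),
`PPowerTowers`, `TameCutStage`, `LatencyCutCells`; the `open …Theses` line lives only in the wiring file).]

(Sources: Hauser2010Kangaroo; Moh1987; Hironaka1970Additive; Giraud1975; CossartPiltant2008 Prop. 4.2;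
CossartPiltant2019 Prop. 2.50; EGA IV₄ 16.11.2.)
-/

noncomputable section

open CategoryTheory AlgebraicGeometry IsLocalRing
open Literature.AlgebraicGeometry.Resolution
open Summit.ResolutionOfSingularities.ResolutionOfSingularities.Theorems
open WeakOrderReduction ForcedTowerClasses DivergentTowerClasses MonomialTowerClasses
open HugDimensionClasses HugDimensionKernels SurfaceShadowClasses SurfaceShadowKernels
open NearPointCut (SingularClass)
open AbsoluteContactClasses (IsAbsContactAt SepResidueAt diffIdeal_restrict_le stalkMap_comp_toStalk_eq_stalkHom)
open scoped BigOperators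

namespace Summit.ResolutionOfSingularities.ResolutionOfSingularities.Theorems.HugValuationCut

/-! ## §62 (g24 · NEW · KERNEL) ALONG lens-4's `ForcedTower`: transport, the dichotomy at every stage, FINITELY MANY KANGAROO
JUMPS ⟹ CONTACT HUGGING (31571's class), and — over a perfect field — weak contact EXISTS at every `p`-power
stage of weight `p` -/

section WeakTowers

variable {k : Type} [Field k]

/-- **TRANSPORT ALONG THE TOWER (KERNEL, PROVED)**: the weak-contact invariant at stage `i` along `H` puts the next marked point
on the strict transform of `H`, keeps it a regular hypersurface germ there, and leaves an exceptionally divisible tail.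
(Sources: Hauser2010Kangaroo; EncinasVillamayor2000, Thm. 4.9.) -/
theorem wInv_succ_transport (T : ForcedTower) (g : T.St 0 ⟶ Spec (.of k)) (hB : IsBase (T.St 0) g) {n : ℕ}
    (hn : 1 ≤ n) (hD : IsDatum n (T.D 0)) (i : ℕ) (H : (T.St i).IdealSheafData) (h : WInv (T.D i).ideal H n (T.pt i)) :
    ∃ z' : (T.St (i + 1)).presheaf.stalk (T.pt (i + 1)),
      stalkIdeal (strictTransformIdeal (T.π i) (T.centre i) H) (T.pt (i + 1)) = Ideal.span {z'} ∧
      z' ∈ maximalIdeal _ ∧ z' ∉ maximalIdeal _ ^ 2 ∧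
      ∃ w ∈ stalkIdeal (T.D (i + 1)).ideal (T.pt (i + 1)), ∃ c' : (T.St (i + 1)).presheaf.stalk (T.pt (i + 1)),
        IsUnit c' ∧ w - c' * z' ^ n ∈ stalkIdeal ((T.centre i).comap (T.π i)) (T.pt (i + 1)) := by
  obtain ⟨hNi, hRi⟩ := tower_isLocallyNoetherian_isRegular T g hB i
  obtain ⟨hNi1, -⟩ := tower_isLocallyNoetherian_isRegular T g hB (i + 1)
  haveI := hNi
  haveI := hNi1
  have hπ := T.isBlowup i
  have hy : (T.π i).base (T.pt (i + 1)) = T.pt i := T.pt_map i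
  have hDi1 : (T.D (i + 1)).ideal = controlledTransform (T.π i) (T.centre i) (T.D i).ideal n := by
    rw [T.transform_eq i, MarkedIdeal.transform_ideal, tower_mult_eq T hD i]
  rw [hDi1]
  have h' : WInv (T.D i).ideal H n ((T.π i).base (T.pt (i + 1))) := by rw [hy]; exact h
  have hIn : stalkIdeal (T.D i).ideal ((T.π i).base (T.pt (i + 1))) ≤ maximalIdeal _ ^ n := by
    rw [hy]; exact tower_stalkIdeal_le_pow T hD i
  have hI'1 : stalkIdeal (controlledTransform (T.π i) (T.centre i) (T.D i).ideal n) (T.pt (i + 1)) ≤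
      maximalIdeal _ := by
    have h1 := tower_stalkIdeal_le_pow T hD (i + 1)
    rw [hDi1] at h1
    exact h1.trans (Ideal.pow_le_self (by omega))
  have hpt' : ((T.centre i).support : Set (T.St i)) = {(T.π i).base (T.pt (i + 1))} := by
    rw [hy]; exact T.centre_support i
  have hcl : IsClosed ({(T.π i).base (T.pt (i + 1))} : Set (T.St i)) := by rw [hy]; exact T.isClosed_pt i
  exact wInv_point_transport hπ hRi (T.centre_regular i) _ H n _ hcl hpt' hIn hI'1 h'

/-- **THE KANGAROO DICHOTOMY AT EVERY STAGE (KERNEL, PROVED)**: weak contact at stage `i` along `H` ⟹ at stage `i + 1`, along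
the strict transform, EITHER weak contact again (no jump) OR a typed kangaroo jump. (Sources: Hauser2010Kangaroo; Moh1987.) -/
theorem wInv_or_tailJump_succ (T : ForcedTower) (g : T.St 0 ⟶ Spec (.of k)) (hB : IsBase (T.St 0) g) {n : ℕ}
    (hn : 1 ≤ n) (hD : IsDatum n (T.D 0)) (i : ℕ) (H : (T.St i).IdealSheafData) (h : WInv (T.D i).ideal H n (T.pt i)) :
    WInv (T.D (i + 1)).ideal (strictTransformIdeal (T.π i) (T.centre i) H) n (T.pt (i + 1)) ∨
      TailJumpAt (T.D (i + 1)).ideal (strictTransformIdeal (T.π i) (T.centre i) H) ((T.centre i).comap (T.π i)) n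
        (T.pt (i + 1)) := by
  obtain ⟨z', hH', hz'm, hz'2, w, hw, c', hc', hwz⟩ := wInv_succ_transport T g hB hn hD i H h
  by_cases hj : w - c' * z' ^ n ∈ maximalIdeal _ ^ (n + 1)
  · exact Or.inl ⟨z', hH', hz'm, hz'2, w, hw, c', hc', hj⟩
  · exact Or.inr ⟨z', hH', hz'm, hz'2, w, hw, c', hc', hwz, hj⟩

/-- **THE LETTER UPGRADE (KERNEL, PROVED)**: weak contact at stage `i` along `H` + the census letter `ShapeAt` at stage `i + 1`
along the strict transform ⟹ the FULL invariant at stage `i + 1` — the transport law supplies `x_{i+1} ∈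
V(H')`, `H'_{x_{i+1}} =
(z')` and `z'` a regular parameter; the letter supplies the shape. (Sources: Hauser2010Kangaroo;
EncinasVillamayor2000, Thm. 4.9.) -/
theorem wInv_succ_of_shapeAt (T : ForcedTower) (g : T.St 0 ⟶ Spec (.of k)) (hB : IsBase (T.St 0) g) {n : ℕ}
    (hn : 1 ≤ n) (hD : IsDatum n (T.D 0)) (i : ℕ) (H : (T.St i).IdealSheafData) (h : WInv (T.D i).ideal H n (T.pt i))
    (hs : ShapeAt (T.D (i + 1)).ideal (strictTransformIdeal (T.π i) (T.centre i) H) n (T.pt (i + 1))) :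
    WInv (T.D (i + 1)).ideal (strictTransformIdeal (T.π i) (T.centre i) H) n (T.pt (i + 1)) := by
  obtain ⟨z', hH', hz'm, hz'2, -⟩ := wInv_succ_transport T g hB hn hD i H h
  obtain ⟨f, hfI, c, hc, hfz⟩ := hs z' hH'
  exact ⟨z', hH', hz'm, hz'2, f, hfI, c, hc, hfz⟩

/-- under the tower binders the invariant at the next stage ⟺ the letter there (given the invariant now). [folklore] -/
theorem wInv_succ_iff_shapeAt (T : ForcedTower) (g : T.St 0 ⟶ Spec (.of k)) (hB : IsBase (T.St 0) g) {n : ℕ}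
    (hn : 1 ≤ n) (hD : IsDatum n (T.D 0)) (i : ℕ) (H : (T.St i).IdealSheafData) (h : WInv (T.D i).ideal H n (T.pt i)) :
    WInv (T.D (i + 1)).ideal (strictTransformIdeal (T.π i) (T.centre i) H) n (T.pt (i + 1)) ↔
      ShapeAt (T.D (i + 1)).ideal (strictTransformIdeal (T.π i) (T.centre i) H) n (T.pt (i + 1)) :=
  ⟨shapeAt_of_wInv, wInv_succ_of_shapeAt T g hB hn hD i H h⟩

/-- **`JumpFreeFrom T n m H` — NO KANGAROO JUMP FROM STAGE `m` ON, along the germ ideal `H` on stage `m`**: the weak-contact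
invariant holds at EVERY stage `m + j` along the iterated strict transform of `H` (NEW TYPED PREDICATE; census: the transported
coordinate hyperplane stays the weak-contact hyperplane at every replayed node). -/
def JumpFreeFrom (T : ForcedTower) (n m : ℕ) (H : (T.St m).IdealSheafData) : Prop :=
  ∀ j, WInv (T.D (m + j)).ideal (strictIter T m H j) n (T.pt (m + j))

/-- **`EventuallyJumpFree n T` — FINITELY MANY KANGAROO JUMPS**: from some stage on, along some germ, no jump (NEW
TYPED PREDICATE;
the DECIDED side of the g24 cut). -/
def EventuallyJumpFree (n : ℕ) (T : ForcedTower) : Prop :=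
  ∃ (m : ℕ) (H : (T.St m).IdealSheafData), JumpFreeFrom T n m H

/-- **`ShapeStableFrom T n m H` — THE CENSUS READING of «no jump from stage `m` on»**: weak contact at stage `m` along `H`
and the LETTER `ShapeAt` at every later stage along the transported germ («in_n(f) = c̄·Z^n in the transported
coordinate at every
replayed node»). -/
def ShapeStableFrom (T : ForcedTower) (n m : ℕ) (H : (T.St m).IdealSheafData) : Prop :=
  WInv (T.D m).ideal H n (T.pt m) ∧ ∀ j, ShapeAt (T.D (m + (j + 1))).ideal (strictIter T m H (j + 1)) n (T.pt (m + (j + 1)))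

/-- **THE LETTER UPGRADE ALONG THE TOWER (KERNEL, PROVED)**: the census reading ⟹ no kangaroo jump from stage `m`
on (induction
on the stage; each step is the transport law). (Sources: Hauser2010Kangaroo.) -/
theorem jumpFreeFrom_of_shapeStableFrom (T : ForcedTower) (g : T.St 0 ⟶ Spec (.of k)) (hB : IsBase (T.St 0) g)
    {n : ℕ} (hn : 1 ≤ n) (hD : IsDatum n (T.D 0)) (m : ℕ) (H : (T.St m).IdealSheafData) (h : ShapeStableFrom T n m H) :
    JumpFreeFrom T n m H := by
  intro j
  induction j with
  | zero => exact h.1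
  | succ j ih => exact wInv_succ_of_shapeAt T g hB hn hD (m + j) (strictIter T m H j) ih (h.2 j)

/-- under the tower binders: no jump from stage `m` on ⟺ the census reading. [folklore] -/
theorem jumpFreeFrom_iff_shapeStableFrom (T : ForcedTower) (g : T.St 0 ⟶ Spec (.of k)) (hB : IsBase (T.St 0) g)
    {n : ℕ} (hn : 1 ≤ n) (hD : IsDatum n (T.D 0)) (m : ℕ) (H : (T.St m).IdealSheafData) :
    JumpFreeFrom T n m H ↔ ShapeStableFrom T n m H :=
  ⟨fun h => ⟨h 0, fun j => shapeAt_of_wInv (h (j + 1))⟩, jumpFreeFrom_of_shapeStableFrom T g hB hn hD m H⟩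

/-- **THE RESIDUAL'S SIGNATURE IS DERIVED, NOT ASSUMED (KERNEL, PROVED)**: weak contact at stage `m` along `H` and NOT
jump-free from `m` on ⟹ after finitely many jump-free stages a TYPED KANGAROO JUMP occurs along the transported germ (minimal
failing stage + the dichotomy `wInv_or_tailJump_succ`). (Sources: Hauser2010Kangaroo; Moh1987.) -/
theorem exists_tailJump_of_not_jumpFreeFrom (T : ForcedTower) (g : T.St 0 ⟶ Spec (.of k)) (hB : IsBase (T.St 0) g)
    {n : ℕ} (hn : 1 ≤ n) (hD : IsDatum n (T.D 0)) (m : ℕ) (H : (T.St m).IdealSheafData)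
    (h0 : WInv (T.D m).ideal H n (T.pt m)) (hJ : ¬ JumpFreeFrom T n m H) :
    ∃ j, WInv (T.D (m + j)).ideal (strictIter T m H j) n (T.pt (m + j)) ∧
      TailJumpAt (T.D (m + (j + 1))).ideal (strictIter T m H (j + 1))
        ((T.centre (m + j)).comap (T.π (m + j))) n (T.pt (m + (j + 1))) := by
  classical
  have hex : ∃ j, ¬ WInv (T.D (m + j)).ideal (strictIter T m H j) n (T.pt (m + j)) := by
    by_contra hcon
    push Not at hcon
    exact hJ hcon
  have h0' : WInv (T.D (m + 0)).ideal (strictIter T m H 0) n (T.pt (m + 0)) := h0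
  have hpos : 0 < Nat.find hex := (Nat.find_pos hex).mpr (not_not.mpr h0')
  obtain ⟨j, hj⟩ : ∃ j, Nat.find hex = j + 1 := ⟨Nat.find hex - 1, by omega⟩
  have hWj : WInv (T.D (m + j)).ideal (strictIter T m H j) n (T.pt (m + j)) :=
    not_not.mp (Nat.find_min hex (show j < Nat.find hex by omega))
  have hnot : ¬ WInv (T.D (m + (j + 1))).ideal (strictIter T m H (j + 1)) n (T.pt (m + (j + 1))) := by
    have h1 := Nat.find_spec hex
    rw [hj] at h1
    exact h1
  refine ⟨j, hWj, ?_⟩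
  rcases wInv_or_tailJump_succ T g hB hn hD (m + j) (strictIter T m H j) hWj with h | h
  · exact absurd h hnot
  · exact h

/-- **KERNEL (PROVED): a jump-free germ is HUGGED FOR EVER** (`HugsGerm` needs no maximal contact). [folklore] -/
theorem hugsGerm_of_jumpFreeFrom {T : ForcedTower} {n m : ℕ} {H : (T.St m).IdealSheafData} (h : JumpFreeFrom T n m H) :
    HugsGerm T m H := by
  have h0 : WInv (T.D m).ideal H n (T.pt m) := h 0
  refine ⟨?_, fun j => mem_support_of_wInv (h j)⟩
  rw [idealOrder_eq_one_of_wInv h0]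
  exact ENat.coe_ne_top 1

/-- **THE DECIDING THEOREM (KERNEL, PROVED): A TOWER WITH FINITELY MANY KANGAROO JUMPS HUGS A REGULAR HYPERSURFACE
GERM FOR EVER**
— `EventuallyJumpFree n T → ContactHugging T`: the eventually jump-free bed lies in 31571's class
`ContactHugging` BY LETTER.
(Sources: Hauser2010Kangaroo; Moh1987; Giraud1975.) -/
theorem contactHugging_of_eventuallyJumpFree {n : ℕ} {T : ForcedTower} (h : EventuallyJumpFree n T) : ContactHugging T := by
  obtain ⟨m, H, hJ⟩ := h
  have h0 : WInv (T.D m).ideal H n (T.pt m) := hJ 0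
  exact ⟨m, H, idealOrder_eq_one_of_wInv h0, hugsGerm_of_jumpFreeFrom hJ⟩

/-- **THE FINITE LAW (KERNEL, PROVED; census-visible): A JUMP-FREE STAGE HUGS ONE MORE STEP** — weak contact at stage `m + j`
along the `j`-th strict transform of `H` puts the marked point of stage `m + j + 1` on the `(j+1)`-st strict transform,
whether or not a jump happens there. (Sources: Hauser2010Kangaroo.) -/
theorem mem_support_strictIter_succ_of_wInv (T : ForcedTower) (g : T.St 0 ⟶ Spec (.of k)) (hB : IsBase (T.St 0) g)
    {n : ℕ} (hn : 1 ≤ n) (hD : IsDatum n (T.D 0)) (m : ℕ) (H : (T.St m).IdealSheafData) (j : ℕ)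
    (h : WInv (T.D (m + j)).ideal (strictIter T m H j) n (T.pt (m + j))) :
    T.pt (m + (j + 1)) ∈ ((strictIter T m H (j + 1)).support : Set (T.St (m + (j + 1)))) := by
  obtain ⟨z', hH', hz'm, -, -⟩ := wInv_succ_transport T g hB hn hD (m + j) (strictIter T m H j) h
  have hmem : T.pt (m + j + 1) ∈
      ((strictTransformIdeal (T.π (m + j)) (T.centre (m + j)) (strictIter T m H j)).support : Set (T.St (m + j + 1))) :=
    (mem_support_iff_stalkIdeal_le _ _).mpr (by rw [hH']; exact (Ideal.span_singleton_le_iff_mem _).mpr hz'm)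
  exact hmem

/-- **`k` CONSECUTIVE JUMP-FREE STAGES HUG `V(H)` FOR `k + 1` STEPS (KERNEL, PROVED; the census fold's
certificate).** [folklore] -/
theorem mem_support_strictIter_of_wInv_lt (T : ForcedTower) (g : T.St 0 ⟶ Spec (.of k)) (hB : IsBase (T.St 0) g)
    {n : ℕ} (hn : 1 ≤ n) (hD : IsDatum n (T.D 0)) (m : ℕ) (H : (T.St m).IdealSheafData) (K : ℕ)
    (h : ∀ j ≤ K, WInv (T.D (m + j)).ideal (strictIter T m H j) n (T.pt (m + j))) :
    ∀ j ≤ K + 1, T.pt (m + j) ∈ ((strictIter T m H j).support : Set (T.St (m + j))) := by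
  intro j hj
  rcases j with _ | j
  · exact mem_support_of_wInv (h 0 (Nat.zero_le _))
  · exact mem_support_strictIter_succ_of_wInv T g hB hn hD m H j (h j (by omega))

/-- **THE WEAK CONTACT THEOREM (KERNEL, PROVED, over a PERFECT field, point level)**: at a CLOSED point `y` of a scheme locally
of finite type over a perfect field of characteristic `p`, an ideal of order EXACTLY `p` which is a `p`-POWER FORM
of weight `p` at
`y` (`PPowerFormAt p 𝓘 p y`: g23's located residual class, weight = characteristic) HAS WEAK CONTACT:
`WeakContactAt p 𝓘 y` — its
initial form is `c̄·Z^p` for a regular parameter `z`.  The span lemma §60 at the perfect residue field `κ(y)`. (Sources: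
Hauser2010Kangaroo; Hironaka1970Additive; CossartPiltant2008, §2; EGAIV4, Thm. 16.11.2.) -/
theorem weakContactAt_of_pPowerFormAt {p : ℕ} (hp : p.Prime) [CharP k p] [PerfectField k] {Y : Scheme.{0}}
    (g : Y ⟶ Spec (.of k)) [LocallyOfFiniteType g] (I : Y.IdealSheafData) {y : Y} (hy : IsClosed ({y} : Set Y))
    (hord : idealOrder I y = ((p : ℕ) : ℕ∞)) (hP : PPowerFormAt p I p y) : WeakContactAt p I y := by
  haveI := Fact.mk hp
  letI := stalkAlgebra (g.appTop.hom.comp (Scheme.ΓSpecIso (.of k)).inv.hom) y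
  haveI : CharP (Y.presheaf.stalk y) p := charP_of_injective_algebraMap (algebraMap k (Y.presheaf.stalk y)).injective p
  obtain ⟨N, hN⟩ : ∃ N, p = N + 1 := ⟨p - 1, by have := hp.one_lt; omega⟩
  have hord' : idealOrder I y = ((N + 1 : ℕ) : ℕ∞) := by rw [← hN]; exact hord
  obtain ⟨-, hnle⟩ := stalkIdeal_le_and_not_le_of_idealOrder I y hord'
  obtain ⟨f, hfI, hf⟩ : ∃ f ∈ stalkIdeal I y, f ∉ maximalIdeal (Y.presheaf.stalk y) ^ (N + 2) := by
    by_contra hcon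
    push Not at hcon
    exact hnle hcon
  have hf' : f ∉ maximalIdeal (Y.presheaf.stalk y) ^ (p + 1) := by rw [hN]; exact hf
  have hperf := exists_pth_root_residue p g hy
  have hle : stalkIdeal I y ≤
      Ideal.span ((fun h : Y.presheaf.stalk y => h ^ p) '' ↑(maximalIdeal (Y.presheaf.stalk y))) ⊔
        maximalIdeal (Y.presheaf.stalk y) ^ (p + 1) := by
    have h2 := hP.2
    rwa [Nat.div_self hp.pos, pow_one] at h2
  obtain ⟨z, hz, hfz⟩ := exists_weakContact_of_le_pPowerSpan p hperf hle hfI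
  exact ⟨z, hz, not_mem_sq_of_pow_congr p (maximalIdeal _) (c := 1) hf' (by rwa [one_mul]), f, hfI, 1, isUnit_one,
    by rwa [one_mul]⟩

/-- **spreading weak contact to a germ ideal (KERNEL, PROVED)**: on a Noetherian scheme, weak contact at `y` is the stage
invariant `WInv 𝓘 H n y` for SOME ideal sheaf `H` with `H_y = (z)` (tree `centreSpread`). [folklore] -/
theorem exists_wInv_of_weakContactAt {Y : Scheme.{0}} [IsNoetherian Y] {n : ℕ} {I : Y.IdealSheafData} {y : Y}
    (h : WeakContactAt n I y) : ∃ H : Y.IdealSheafData, WInv I H n y := by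
  obtain ⟨z, hz, hz2, f, hfI, c, hc, hfz⟩ := h
  have hz0 : z ≠ 0 := fun h0 => hz2 (by rw [h0]; exact zero_mem _)
  have hspan : Ideal.span (Set.range fun _ : Fin 1 => z) = Ideal.span {z} := by rw [Set.range_const]
  obtain ⟨H, -, -, hHst⟩ := FInjectiveMacaulayfication.CentreSpread.centreSpread Y y 1 (fun _ => z)
      (by rw [hspan, Ne, Ideal.span_singleton_eq_bot]; exact hz0)
      (by rw [hspan]; exact (Ideal.span_singleton_le_iff_mem _).mpr hz)
  rw [hspan] at hHst
  exact ⟨H, z, hHst, hz, hz2, f, hfI, c, hc, hfz⟩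

/-- **KERNEL (PROVED, over a PERFECT field): WEAK CONTACT EXISTS AT EVERY `p`-POWER STAGE OF WEIGHT `p`** — at stage `j` of a
forced tower of weight `p = char k` whose stage ideal is a `p`-power form at the marked point there is a germ ideal `H` with
`WInv (T.D j).ideal H p (T.pt j)` (`weakContactAt_of_pPowerFormAt` at the closed point `x_j` + `exists_wInv_of_weakContactAt`).
(Sources: Hauser2010Kangaroo; Hironaka1970Additive; CossartPiltant2008, §2.) -/
theorem exists_wInv_stage_of_pPowerFormAt {p : ℕ} (hp : p.Prime) [CharP k p] [PerfectField k] (T : ForcedTower)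
    (g : T.St 0 ⟶ Spec (.of k)) (hB : IsBase (T.St 0) g) (hD : IsDatum p (T.D 0)) (j : ℕ)
    (hP : PPowerFormAt p (T.D j).ideal p (T.pt j)) :
    ∃ H : (T.St j).IdealSheafData, WInv (T.D j).ideal H p (T.pt j) := by
  haveI : IsNoetherian (T.St j) := tower_isNoetherian T g hB j
  haveI : LocallyOfFiniteType (toRoot T j ≫ g) := (tower_isBase T g hB j).locallyOfFiniteType
  exact exists_wInv_of_weakContactAt
    (weakContactAt_of_pPowerFormAt hp (toRoot T j ≫ g) (T.D j).ideal (T.isClosed_pt j) (tower_idealOrder_pt_eq T g hB hD j) hP)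

/-- **LAW (KERNEL, PROVED, over a PERFECT field): A `p`-POWER STAGE OF WEIGHT `p` HUGS A REGULAR HYPERSURFACE FOR AT LEAST ONE
MORE STEP** — at every stage `j` with `PPowerFormAt p (T.D j).ideal p (T.pt j)` there is a regular hypersurface
germ `V(H) ∋ x_j`
whose strict transform passes through `x_{j+1}`: weak contact is never lost in ONE step (only its `p`-power shape may jump).
(Sources: Hauser2010Kangaroo; Moh1987.) -/
theorem hugs_one_step_of_pPowerFormAt {p : ℕ} (hp : p.Prime) [CharP k p] [PerfectField k] (T : ForcedTower)
    (g : T.St 0 ⟶ Spec (.of k)) (hB : IsBase (T.St 0) g) (hD : IsDatum p (T.D 0)) (j : ℕ)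
    (hP : PPowerFormAt p (T.D j).ideal p (T.pt j)) :
    ∃ H : (T.St j).IdealSheafData, idealOrder H (T.pt j) = 1 ∧ T.pt j ∈ (H.support : Set (T.St j)) ∧
      T.pt (j + 1) ∈ ((strictTransformIdeal (T.π j) (T.centre j) H).support : Set (T.St (j + 1))) ∧
      (WInv (T.D (j + 1)).ideal (strictTransformIdeal (T.π j) (T.centre j) H) p (T.pt (j + 1)) ∨
        TailJumpAt (T.D (j + 1)).ideal (strictTransformIdeal (T.π j) (T.centre j) H) ((T.centre j).comap (T.π j)) p
          (T.pt (j + 1))) := by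
  obtain ⟨H, hW⟩ := exists_wInv_stage_of_pPowerFormAt hp T g hB hD j hP
  obtain ⟨z', hH', hz'm, -, -⟩ := wInv_succ_transport T g hB hp.one_lt.le hD j H hW
  refine ⟨H, idealOrder_eq_one_of_wInv hW, mem_support_of_wInv hW, ?_, wInv_or_tailJump_succ T g hB hp.one_lt.le hD j H hW⟩
  exact (mem_support_iff_stalkIdeal_le _ _).mpr (by rw [hH']; exact (Ideal.span_singleton_le_iff_mem _).mpr hz'm)

/-- **KERNEL (PROVED, over a PERFECT field): A WEIGHT-`p` `p`-POWER TOWER CARRIES WEAK-CONTACT DATA AT EVERY STAGE**, so the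
dichotomy jump / no-jump is defined at every stage of every tower of the g23 residual of weight `p`. [folklore] -/
theorem exists_wInv_every_stage_of_pPowerTower {p : ℕ} (hp : p.Prime) [CharP k p] [PerfectField k] (T : ForcedTower)
    (g : T.St 0 ⟶ Spec (.of k)) (hB : IsBase (T.St 0) g) (hD : IsDatum p (T.D 0)) (hT : PPowerTower p T) :
    ∀ j, ∃ H : (T.St j).IdealSheafData, WInv (T.D j).ideal H p (T.pt j) :=
  fun j => exists_wInv_stage_of_pPowerFormAt hp T g hB hD j ((pPowerTower_iff hp T g).mp hT j)

/-- **THE KANGAROO-RECURRENT SIGNATURE (KERNEL, PROVED)**: a tower that is NOT eventually jump-free has, after EVERY stage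
carrying weak contact along a germ, finitely many jump-free stages and then a TYPED KANGAROO JUMP along the transported germ.
(Sources: Hauser2010Kangaroo; Moh1987.) -/
theorem exists_tailJump_of_not_eventuallyJumpFree (T : ForcedTower) (g : T.St 0 ⟶ Spec (.of k)) (hB : IsBase (T.St 0) g)
    {n : ℕ} (hn : 1 ≤ n) (hD : IsDatum n (T.D 0)) (hT : ¬ EventuallyJumpFree n T) (m : ℕ)
    (H : (T.St m).IdealSheafData) (h0 : WInv (T.D m).ideal H n (T.pt m)) :
    ∃ j, WInv (T.D (m + j)).ideal (strictIter T m H j) n (T.pt (m + j)) ∧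
      TailJumpAt (T.D (m + (j + 1))).ideal (strictIter T m H (j + 1))
        ((T.centre (m + j)).comap (T.π (m + j))) n (T.pt (m + (j + 1))) :=
  exists_tailJump_of_not_jumpFreeFrom T g hB hn hD m H h0 fun hJ => hT ⟨m, H, hJ⟩

/-- **INFINITELY MANY KANGAROO JUMPS (KERNEL, PROVED, over a PERFECT field)**: a weight-`p` `p`-power tower that is
NOT eventually
jump-free has, FROM EVERY STAGE `m`, a weak-contact germ `H ∋ x_m` followed by finitely many jump-free stages and then a typed
kangaroo jump — the residual of the g24 cut at weight `p` is «a kangaroo jump after every stage», by letter.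
(Sources: Hauser2010Kangaroo; Moh1987; Hironaka1970Additive.) -/
theorem tailJump_after_every_stage {p : ℕ} (hp : p.Prime) [CharP k p] [PerfectField k] (T : ForcedTower)
    (g : T.St 0 ⟶ Spec (.of k)) (hB : IsBase (T.St 0) g) (hD : IsDatum p (T.D 0)) (hT : PPowerTower p T)
    (hJ : ¬ EventuallyJumpFree p T) (m : ℕ) :
    ∃ (H : (T.St m).IdealSheafData) (j : ℕ), WInv (T.D m).ideal H p (T.pt m) ∧
      WInv (T.D (m + j)).ideal (strictIter T m H j) p (T.pt (m + j)) ∧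
      TailJumpAt (T.D (m + (j + 1))).ideal (strictIter T m H (j + 1))
        ((T.centre (m + j)).comap (T.π (m + j))) p (T.pt (m + (j + 1))) := by
  obtain ⟨H, hW⟩ := exists_wInv_every_stage_of_pPowerTower hp T g hB hD hT m
  obtain ⟨j, hj, hjump⟩ := exists_tailJump_of_not_eventuallyJumpFree T g hB hp.one_lt.le hD hJ m H hW
  exact ⟨H, j, hW, hj, hjump⟩

/-- **`EventuallyShapeStable n T` — THE CENSUS-LETTER FORM OF THE DECIDED SIDE**: from some stage on, along some weak-contact
germ, the letter `ShapeAt` at every later stage. -/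
def EventuallyShapeStable (n : ℕ) (T : ForcedTower) : Prop :=
  ∃ (m : ℕ) (H : (T.St m).IdealSheafData), ShapeStableFrom T n m H

/-- under the tower binders: eventually jump-free ⟺ eventually shape-stable (the letter upgrade, both ways). [folklore] -/
theorem eventuallyJumpFree_iff_eventuallyShapeStable (T : ForcedTower) (g : T.St 0 ⟶ Spec (.of k))
    (hB : IsBase (T.St 0) g) {n : ℕ} (hn : 1 ≤ n) (hD : IsDatum n (T.D 0)) :
    EventuallyJumpFree n T ↔ EventuallyShapeStable n T :=
  ⟨fun ⟨m, H, h⟩ => ⟨m, H, (jumpFreeFrom_iff_shapeStableFrom T g hB hn hD m H).mp h⟩,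
    fun ⟨m, H, h⟩ => ⟨m, H, (jumpFreeFrom_iff_shapeStableFrom T g hB hn hD m H).mpr h⟩⟩

end WeakTowers

end Summit.ResolutionOfSingularities.ResolutionOfSingularities.Theorems.HugValuationCut
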